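import Summits.AtomisticToContinuum.HydrodynamicLimit.Theorems.CollisionIsometryCLTMacroClosureEngineDefs
import Summits.AtomisticToContinuum.HydrodynamicLimit.Theorems.CollisionIsometryCLTMacroClosureStubClausiusDV
import Summits.AtomisticToContinuum.HydrodynamicLimit.Theorems.CollisionIsometryCLTMacroClosureStubClausiusStatics
import Summits.AtomisticToContinuum.HydrodynamicLimit.Theorems.CollisionIsometryCLTMacroClosureStubClausiusIdentify
import Literature.Analysis.FunctionSpaces.TorusSpaceTime
import HarnessLib

/-!
# Sub-goal `engine_initial` of the lead's stub `stub_engine` (line `IdeatorTwoGen1Sketch`, crux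
# `MacroClosure`, stmt-AtomisticToContinuum-14870): the initial term of the Gronwall vanishes

For a classical hs-Euler solution `(ρ, u, θ)` on `[0, T)`, `0 < T`, staying in the dilute chamber of
`ThermoChamber η₃`, local Gibbs initial laws `P_N = localGibbsLaw σ a₀ u₀ θ₀ N (Φ N)` (`σ ≤ 1/2`,
continuous positive profiles) whose time-`0` empirical fields converge in probability to
`(ρ, ρu, E)(0)` (`TendstoHydroFieldsAt … 0`), and good events `G_N` with `P_N(G_Nᶜ) → 0`, the
initial linear statistic vanishes in the limit:
`E_{P_N}[𝟙_{G_N} (Obs(0, ·) − ∫ₓ Λ_cl(0,x)·U_cl(0,x) dx)] → 0`.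

Proof. By clause 3 of `ThermoChamber`, `Λ_cl(0,x) V = λ⁰ V.1 + Σⱼ λᵐⱼ V.2.1 j + λᴱ V.2.2` with the
continuous weights `λ⁰ = lam0 … 0`, `λᵐ = lamM θ u 0 = θ⁻¹u`, `λᴱ = lamE θ 0 = −θ⁻¹` (continuity of
`λ⁰` from the joint smoothness of `Λ` evaluated at `(1, 0, 0)`), so
`∫ₓ Λ_cl·U_cl = ∫ λ⁰ρ + Σⱼ ∫ λᵐⱼ ρuⱼ + ∫ λᴱ E` at time `0`, while
`Obs(0, z) = ⟨emp z, λ⁰⟩ + Σⱼ ⟨emp z, λᵐⱼ vⱼ⟩ + ⟨emp z, λᴱ |v|²/2⟩` is the sum of the empirical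
density / momentum / energy fields tested with these weights. The `t = 0` law of large numbers
(through `Φ_0 = id` a.s., `Clausius.localGibbsLaw_setOf_flow_zero`) gives convergence in
probability of each of the five pieces, hence of `Obs(0, ·)` to `∫ₓ Λ_cl·U_cl`; the weights are
bounded, so `|Obs(0,z)| ≤ A + B ⟨emp z, |v|²/2⟩` and the uniform second moment of the kinetic
energy (`stub_clausius_moment`) bounds `E[X_N²]` uniformly; `Clausius.tendsto_integral_indicator`
concludes.
-/

noncomputable section

open MeasureTheory Filter Set Topology InformationTheory
open scoped ENNReal ContDiff

namespace Summit.AtomisticToContinuum.HydrodynamicLimit.Theorems.MacroClosureLine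

open Literature.MathematicalPhysics.KineticTheory Literature.Analysis.FluidPDE
open Literature.Analysis.FunctionSpaces

namespace Barycentric

namespace EngineInitial

/-! ## Convergence in probability: sums and coordinates -/

section InProb

variable {Ω : ℕ → Type*} [∀ N, MeasurableSpace (Ω N)] (P : (N : ℕ) → Measure (Ω N))

/-- Sums of two sequences converging in probability converge in probability to the sum of the
limits. -/
theorem tendsto_measure_add {A B : (N : ℕ) → Ω N → ℝ} {a b : ℝ}
    (hA : ∀ δ : ℝ, 0 < δ → Tendsto (fun N => P N {w | δ < |A N w - a|}) atTop (𝓝 0))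
    (hB : ∀ δ : ℝ, 0 < δ → Tendsto (fun N => P N {w | δ < |B N w - b|}) atTop (𝓝 0)) :
    ∀ δ : ℝ, 0 < δ →
      Tendsto (fun N => P N {w | δ < |(A N w + B N w) - (a + b)|}) atTop (𝓝 0) := by
  intro δ hδ
  have h2 : 0 < δ / 2 := by positivity
  refine tendsto_of_tendsto_of_tendsto_of_le_of_le tendsto_const_nhds
    (by simpa using (hA _ h2).add (hB _ h2)) (fun _ => zero_le) fun N => ?_
  calc P N {w | δ < |(A N w + B N w) - (a + b)|}
      ≤ P N ({w | δ / 2 < |A N w - a|} ∪ {w | δ / 2 < |B N w - b|}) := by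
        refine measure_mono fun w hw => ?_
        simp only [mem_setOf_eq, mem_union] at hw ⊢
        by_contra h
        simp only [not_or, not_lt] at h
        have hle : |(A N w + B N w) - (a + b)| ≤ |A N w - a| + |B N w - b| := by
          calc |(A N w + B N w) - (a + b)| = |(A N w - a) + (B N w - b)| := by
                congr 1; ring
            _ ≤ |A N w - a| + |B N w - b| := abs_add_le _ _
        linarith [h.1, h.2]
    _ ≤ P N {w | δ / 2 < |A N w - a|} + P N {w | δ / 2 < |B N w - b|} := measure_union_le _ _

/-- Finite sums of sequences converging in probability converge in probability to the sum of the
limits. -/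
theorem tendsto_measure_sum {ι : Type*} (s : Finset ι) {A : ι → (N : ℕ) → Ω N → ℝ} {a : ι → ℝ}
    (h : ∀ i ∈ s, ∀ δ : ℝ, 0 < δ →
      Tendsto (fun N => P N {w | δ < |A i N w - a i|}) atTop (𝓝 0)) :
    ∀ δ : ℝ, 0 < δ →
      Tendsto (fun N => P N {w | δ < |(∑ i ∈ s, A i N w) - ∑ i ∈ s, a i|}) atTop (𝓝 0) := by
  classical
  induction s using Finset.induction_on with
  | empty =>
      intro δ hδ
      simp only [Finset.sum_empty, sub_self, abs_zero, not_lt.2 hδ.le, setOf_false, measure_empty]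
      exact tendsto_const_nhds
  | @insert i s hi ih =>
      intro δ hδ
      have h' := tendsto_measure_add P (h i (Finset.mem_insert_self i s))
        (ih fun j hj => h j (Finset.mem_insert_of_mem hj)) δ hδ
      simpa only [Finset.sum_insert hi] using h'

/-- A coordinate of a vector-valued sequence converging in probability converges in probability. -/
theorem tendsto_measure_apply {M : (N : ℕ) → Ω N → V3} {m : V3}
    (h : ∀ δ : ℝ, 0 < δ → Tendsto (fun N => P N {w | δ < ‖M N w - m‖}) atTop (𝓝 0)) (j : Fin 3) :
    ∀ δ : ℝ, 0 < δ → Tendsto (fun N => P N {w | δ < |M N w j - m j|}) atTop (𝓝 0) := by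
  intro δ hδ
  refine tendsto_of_tendsto_of_tendsto_of_le_of_le tendsto_const_nhds (h δ hδ) (fun _ => zero_le)
    fun N => measure_mono fun w hw => ?_
  simp only [mem_setOf_eq] at hw ⊢
  have h1 : |(M N w - m) j| ≤ ‖M N w - m‖ := by simpa using PiLp.norm_apply_le (M N w - m) j
  rw [PiLp.sub_apply] at h1
  exact lt_of_lt_of_le hw h1

end InProb

/-! ## The tested observable: field decomposition, a priori bound, measurability -/

/-- `Obs(s, w)` is the sum of the empirical density, momentum and energy fields of `w` tested with
the weights `λ⁰(s,·)`, `λᵐⱼ(s,·)`, `λᴱ(s,·)`. -/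
theorem obs_eq_fields (σ : ℝ) (ρ θ : ℝ → T3 → ℝ) (u : ℝ → T3 → V3) (s : ℝ) {n : ℕ}
    (w : Config n (Fin 3) T3) :
    obs σ ρ θ u s w = empiricalDensityField w (lam0 σ ρ θ u s) +
      (∑ j, empiricalMomentumField w (fun x => lamM θ u s x j) j) +
      empiricalEnergyField w (lamE θ s) := by
  simp only [obs, empiricalDensityField, empiricalEnergyField, empiricalMomentumField_eq_sum,
    integral_empiricalMeasure, PiLp.smul_apply, WithLp.ofLp_sum, Finset.sum_apply, smul_eq_mul]
  rw [← Finset.mul_sum, Finset.sum_comm, ← mul_add, ← mul_add, ← Finset.sum_add_distrib,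
    ← Finset.sum_add_distrib]

/-- A priori bound: with `|λ⁰| ≤ A0`, `|λᵐⱼ| ≤ AM`, `|λᴱ| ≤ AE`,
`|Obs(s, w)| ≤ (A0 + 3AM/2) + (3AM + AE) ⟨emp w, |v|²/2⟩` (using `|vⱼ| ≤ (1 + |v|²)/2`). -/
theorem abs_obs_le {σ : ℝ} {ρ θ : ℝ → T3 → ℝ} {u : ℝ → T3 → V3} {s A0 AM AE : ℝ}
    (h0 : ∀ x, |lam0 σ ρ θ u s x| ≤ A0) (hM : ∀ x j, |lamM θ u s x j| ≤ AM)
    (hE : ∀ x, |lamE θ s x| ≤ AE) {n : ℕ} (w : Config (n + 1) (Fin 3) T3) :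
    |obs σ ρ θ u s w| ≤
      (A0 + 3 * AM / 2) + (3 * AM + AE) * empiricalEnergyField w fun _ => (1 : ℝ) := by
  have hAM : 0 ≤ AM := (abs_nonneg _).trans (hM 0 0)
  have hN : (0 : ℝ) < (n : ℝ) + 1 := by positivity
  set t : Fin (n + 1) → ℝ := fun i => lam0 σ ρ θ u s (w i).1 +
    (∑ j, lamM θ u s (w i).1 j * (w i).2 j) + lamE θ s (w i).1 * (‖(w i).2‖ ^ 2 / 2) with ht
  have hobs : obs σ ρ θ u s w = ((n : ℝ) + 1)⁻¹ * ∑ i, t i := by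
    rw [show obs σ ρ θ u s w = _ from integral_empiricalMeasure w _]
    push_cast
    rfl
  have he : (empiricalEnergyField w fun _ => (1 : ℝ)) = ((n : ℝ) + 1)⁻¹ * ∑ i, ‖(w i).2‖ ^ 2 / 2 := by
    rw [empiricalEnergyField_eq_sum]; push_cast; simp
  have hterm : ∀ i, |t i| ≤ (A0 + 3 * AM / 2) + (3 * AM + AE) * (‖(w i).2‖ ^ 2 / 2) := by
    intro i
    have hv : ∀ j, |(w i).2 j| ≤ (1 + ‖(w i).2‖ ^ 2) / 2 := fun j => by
      have h1 : |(w i).2 j| ≤ ‖(w i).2‖ := by simpa using PiLp.norm_apply_le (w i).2 j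
      nlinarith [sq_nonneg (‖(w i).2‖ - 1), norm_nonneg (w i).2]
    have h2 : |∑ j, lamM θ u s (w i).1 j * (w i).2 j| ≤ 3 * (AM * ((1 + ‖(w i).2‖ ^ 2) / 2)) := by
      calc |∑ j, lamM θ u s (w i).1 j * (w i).2 j| ≤ ∑ j, |lamM θ u s (w i).1 j * (w i).2 j| :=
            Finset.abs_sum_le_sum_abs _ _
        _ ≤ ∑ _j : Fin 3, AM * ((1 + ‖(w i).2‖ ^ 2) / 2) := Finset.sum_le_sum fun j _ => by
            rw [abs_mul]
            exact mul_le_mul (hM _ j) (hv j) (abs_nonneg _) hAM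
        _ = 3 * (AM * ((1 + ‖(w i).2‖ ^ 2) / 2)) := by simp
    have h3 : |lamE θ s (w i).1 * (‖(w i).2‖ ^ 2 / 2)| ≤ AE * (‖(w i).2‖ ^ 2 / 2) := by
      rw [abs_mul, abs_of_nonneg (by positivity : (0 : ℝ) ≤ ‖(w i).2‖ ^ 2 / 2)]
      exact mul_le_mul_of_nonneg_right (hE _) (by positivity)
    calc |t i| ≤ |lam0 σ ρ θ u s (w i).1| + |∑ j, lamM θ u s (w i).1 j * (w i).2 j| +
          |lamE θ s (w i).1 * (‖(w i).2‖ ^ 2 / 2)| := abs_add_three _ _ _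
      _ ≤ (A0 + 3 * AM / 2) + (3 * AM + AE) * (‖(w i).2‖ ^ 2 / 2) := by
          linarith [h0 (w i).1, h2, h3]
  rw [hobs, he, abs_mul, abs_of_pos (inv_pos.2 hN)]
  calc ((n : ℝ) + 1)⁻¹ * |∑ i, t i| ≤ ((n : ℝ) + 1)⁻¹ * ∑ i, |t i| :=
        mul_le_mul_of_nonneg_left (Finset.abs_sum_le_sum_abs _ _) (inv_nonneg.2 hN.le)
    _ ≤ ((n : ℝ) + 1)⁻¹ * ∑ i, ((A0 + 3 * AM / 2) + (3 * AM + AE) * (‖(w i).2‖ ^ 2 / 2)) :=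
        mul_le_mul_of_nonneg_left (Finset.sum_le_sum fun i _ => hterm i) (inv_nonneg.2 hN.le)
    _ = (A0 + 3 * AM / 2) + (3 * AM + AE) * (((n : ℝ) + 1)⁻¹ * ∑ i, ‖(w i).2‖ ^ 2 / 2) := by
        rw [Finset.sum_add_distrib, Finset.sum_const, Finset.card_univ, Fintype.card_fin,
          nsmul_eq_mul, ← Finset.mul_sum]
        push_cast
        field_simp

/-- `Obs(s, ·)` is measurable on `(n + 1)`-particle phase space when the weights are continuous. -/
theorem measurable_obs {σ : ℝ} {ρ θ : ℝ → T3 → ℝ} {u : ℝ → T3 → V3} {s : ℝ}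
    (h0 : Continuous (lam0 σ ρ θ u s)) (hM : Continuous (lamM θ u s)) (hE : Continuous (lamE θ s))
    (n : ℕ) : Measurable fun w : Config (n + 1) (Fin 3) T3 => obs σ ρ θ u s w := by
  have hvj : ∀ j : Fin 3, Continuous fun v : V3 => v j := fun j => PiLp.continuous_apply 2 _ j
  have hF : Continuous fun y : T3 × V3 =>
      lam0 σ ρ θ u s y.1 + (∑ j, lamM θ u s y.1 j * y.2 j) + lamE θ s y.1 * (‖y.2‖ ^ 2 / 2) := by
    refine ((h0.comp continuous_fst).add (continuous_finsetSum _ fun j _ => ?_)).add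
      ((hE.comp continuous_fst).mul ((continuous_snd.norm.pow 2).div_const _))
    exact ((hvj j).comp (hM.comp continuous_fst)).mul ((hvj j).comp continuous_snd)
  have heq : (fun w : Config (n + 1) (Fin 3) T3 => obs σ ρ θ u s w) =
      fun w => ((n + 1 : ℕ) : ℝ)⁻¹ * ∑ i, (lam0 σ ρ θ u s (w i).1 +
        (∑ j, lamM θ u s (w i).1 j * (w i).2 j) + lamE θ s (w i).1 * (‖(w i).2‖ ^ 2 / 2)) := by
    funext w
    exact integral_empiricalMeasure w _
  rw [heq]
  exact measurable_const.mul
    (Finset.measurable_sum _ fun i _ => hF.measurable.comp (measurable_pi_apply i))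

end EngineInitial

/-! ## The sub-goal -/

/-- **`engine_initial` (registered sub-goal of `stub_engine`): the initial term of the Gronwall
vanishes.** Under the `t = 0` law of large numbers of the local Gibbs laws towards the classical data,
`E_{P_N}[𝟙_{G_N}(Obs(0,·) − ∫ₓ Λ_cl(0,x)·U_cl(0,x) dx)] → 0` for any measurable good events `G_N`
with `P_N(G_Nᶜ) → 0`: `Obs(0,·)` converges in probability to `∫ₓ Λ_cl·U_cl` (clause 3 of
`ThermoChamber` makes both sides the same linear combination of density / momentum / energy
fields), its second moments are uniformly bounded (`stub_clausius_moment`), and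
`Clausius.tendsto_integral_indicator` upgrades this to means on the good event. -/
theorem engine_initial : ∀ (σ : ℝ), 0 < σ → σ ≤ 1 / 2 → ∀ (a₀ θ₀ : T3 → ℝ) (u₀ : T3 → V3), Continuous a₀ → Continuous θ₀ → Continuous u₀ → (∀ x, 0 < a₀ x) → (∀ x, 0 < θ₀ x) → ∀ (T : ℝ) (ρ θ : ℝ → T3 → ℝ) (u : ℝ → T3 → V3), IsHardSphereEulerSolution σ T ρ u θ → 0 < T → ∀ η₃ : ℝ, ThermoChamber η₃ → (∀ s ∈ Ico 0 T, ∀ x, ρ s x * σ ^ 3 < η₃) → ∀ (Φ : (N : ℕ) → Flow σ N), TendstoHydroFieldsAt (fun N => localGibbsLaw σ a₀ u₀ θ₀ N (Φ N)) Φ ρ u θ 0 → ∀ G : (N : ℕ) → Set (Config (N + 1) (Fin 3) T3), (∀ N, MeasurableSet (G N)) → (∀ N, G N ⊆ (Φ N).good) → Tendsto (fun N : ℕ => localGibbsLaw σ a₀ u₀ θ₀ N (Φ N) (G N)ᶜ) atTop (𝓝 0) → Tendsto (fun N : ℕ => ∫ z, (G N).indicator (fun z => obs σ ρ θ u 0 z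 - ∫ x, Lcl σ ρ θ u 0 x (Ucl ρ θ u 0 x)) z ∂(localGibbsLaw σ a₀ u₀ θ₀ N (Φ N))) atTop (𝓝 0) := by
  intro σ hσ hσ2 a₀ θ₀ u₀ ha hθ hu ha0 hθ0 T ρ θ u hE hT0 η₃ hTC hpack Φ hLLN G hG _hGgood hGc
  haveI : ∀ N, IsProbabilityMeasure (localGibbsLaw σ a₀ u₀ θ₀ N (Φ N)) := fun N =>
    isProbabilityMeasure_localGibbsLaw ha hθ hu ha0 hθ0 hσ2 N (Φ N)
  set P : (N : ℕ) → Measure (Config (N + 1) (Fin 3) T3) := fun N => localGibbsLaw σ a₀ u₀ θ₀ N (Φ N)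
    with hPdef
  have h0T : (0 : ℝ) ∈ Ico 0 T := ⟨le_rfl, hT0⟩
  -- clause 3 of `ThermoChamber`: `Λ = Dη_σ(U_cl)` is jointly smooth with explicit form
  obtain ⟨hΛ, hΛeq, -, -⟩ := (hTC σ hσ).2.2 T ρ θ u hE hpack
  have hinner : ∀ a b : V3, inner ℝ a b = ∑ j, a j * b j := fun a b => by
    rw [PiLp.inner_apply]
    exact Finset.sum_congr rfl fun j _ => by rw [RCLike.inner_apply, conj_trivial, mul_comm]
  have hL : ∀ s ∈ Ico 0 T, ∀ (x : T3) (V : State), Lcl σ ρ θ u s x V =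
      lam0 σ ρ θ u s x * V.1 + (∑ j, lamM θ u s x j * V.2.1 j) + lamE θ s x * V.2.2 := by
    intro s hs x V
    have h := hΛeq s hs x V
    rw [← hinner]
    simp only [Lcl, Ucl, lam0, lamM, lamE]
    rw [h]
    ring
  -- continuity of the classical fields and of the weights at time `0`
  have hρc : Continuous (ρ 0) := (hE.smooth_density.isSmooth_slice h0T).continuous
  have huc : Continuous (u 0) := (hE.smooth_velocity.isSmooth_slice h0T).continuous
  have hθc : Continuous (θ 0) := (hE.smooth_temperature.isSmooth_slice h0T).continuous
  have hθpos : ∀ x, 0 < θ 0 x := hE.temperature_pos 0 h0T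
  have hst0 : Torus.IsSmoothSpaceTimeOn (Ico 0 T) (lam0 σ ρ θ u) := by
    refine (hΛ.clm_comp
      (ContinuousLinearMap.apply ℝ ℝ (((1 : ℝ), ((0 : V3), (0 : ℝ))) : State))).congr ?_
    rintro ⟨s, y⟩ hp
    have hs : s ∈ Ico 0 T := (mem_prod.1 hp).1
    simp only [Torus.stLift_apply, ContinuousLinearMap.apply_apply]
    rw [hΛeq s hs]
    simp [lam0]
  have hc0 : Continuous (lam0 σ ρ θ u 0) := (hst0.isSmooth_slice h0T).continuous
  have hθinv : Continuous fun x => (θ 0 x)⁻¹ := hθc.inv₀ fun x => (hθpos x).ne'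
  have hcM : Continuous (lamM θ u 0) := hθinv.smul huc
  have hcE : Continuous (lamE θ 0) := hθinv.neg
  have hcMj : ∀ j, Continuous fun x => lamM θ u 0 x j := fun j => by fun_prop
  have hEc : Continuous fun x => totalEnergyDensity (ρ 0 x) (u 0 x) (θ 0 x) :=
    Clausius.continuous_totalEnergyDensity_comp hρc huc hθc
  -- the classical constant as a sum of tested classical fields
  have hc_eq : (∫ x, Lcl σ ρ θ u 0 x (Ucl ρ θ u 0 x)) =
      (∫ x, lam0 σ ρ θ u 0 x * ρ 0 x) +
        (∑ j, (∫ x, (lamM θ u 0 x j * ρ 0 x) • u 0 x) j) +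
        ∫ x, lamE θ 0 x * totalEnergyDensity (ρ 0 x) (u 0 x) (θ 0 x) := by
    have hpt : ∀ x, Lcl σ ρ θ u 0 x (Ucl ρ θ u 0 x) = lam0 σ ρ θ u 0 x * ρ 0 x +
        (∑ j, lamM θ u 0 x j * ρ 0 x * u 0 x j) +
        lamE θ 0 x * totalEnergyDensity (ρ 0 x) (u 0 x) (θ 0 x) := by
      intro x
      rw [hL 0 h0T x]
      simp only [Ucl, stateOf, PiLp.smul_apply, smul_eq_mul, mul_assoc]
    simp_rw [hpt]
    have i0 : Integrable (fun x => lam0 σ ρ θ u 0 x * ρ 0 x) :=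
      integrable_of_continuous_T3 (hc0.mul hρc)
    have iMj : ∀ j, Integrable (fun x => lamM θ u 0 x j * ρ 0 x * u 0 x j) := fun j =>
      integrable_of_continuous_T3 (by fun_prop)
    have iM : Integrable (fun x => ∑ j, lamM θ u 0 x j * ρ 0 x * u 0 x j) :=
      integrable_finsetSum _ fun j _ => iMj j
    have iE : Integrable (fun x => lamE θ 0 x * totalEnergyDensity (ρ 0 x) (u 0 x) (θ 0 x)) :=
      integrable_of_continuous_T3 (hcE.mul hEc)
    have i0M : Integrable (fun x => lam0 σ ρ θ u 0 x * ρ 0 x +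
        ∑ j, lamM θ u 0 x j * ρ 0 x * u 0 x j) := i0.add iM
    rw [integral_add i0M iE, integral_add i0 iM, integral_finsetSum _ fun j _ => iMj j]
    congr 2
    refine Finset.sum_congr rfl fun j _ => ?_
    rw [Clausius.integral_smul_apply (by fun_prop) huc j]
  -- the five laws of large numbers at time `0` (through `Φ_0 = id` almost surely)
  have hD : ∀ δ : ℝ, 0 < δ → Tendsto (fun N => P N
      {z | δ < |empiricalDensityField z (lam0 σ ρ θ u 0) - ∫ x, lam0 σ ρ θ u 0 x * ρ 0 x|})
      atTop (𝓝 0) := by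
    intro δ hδ
    refine (hLLN _ hc0 δ hδ).1.congr fun N => ?_
    exact Clausius.localGibbsLaw_setOf_flow_zero a₀ u₀ θ₀ N (Φ N)
      (fun z => δ < |empiricalDensityField z (lam0 σ ρ θ u 0) - ∫ x, lam0 σ ρ θ u 0 x * ρ 0 x|)
  have hMv : ∀ j, ∀ δ : ℝ, 0 < δ → Tendsto (fun N => P N
      {z | δ < ‖empiricalMomentumField z (fun x => lamM θ u 0 x j) -
        ∫ x, (lamM θ u 0 x j * ρ 0 x) • u 0 x‖}) atTop (𝓝 0) := by
    intro j δ hδ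
    refine (hLLN _ (hcMj j) δ hδ).2.1.congr fun N => ?_
    exact Clausius.localGibbsLaw_setOf_flow_zero a₀ u₀ θ₀ N (Φ N)
      (fun z => δ < ‖empiricalMomentumField z (fun x => lamM θ u 0 x j) -
        ∫ x, (lamM θ u 0 x j * ρ 0 x) • u 0 x‖)
  have hM : ∀ j, ∀ δ : ℝ, 0 < δ → Tendsto (fun N => P N
      {z | δ < |empiricalMomentumField z (fun x => lamM θ u 0 x j) j -
        (∫ x, (lamM θ u 0 x j * ρ 0 x) • u 0 x) j|}) atTop (𝓝 0) := fun j =>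
    EngineInitial.tendsto_measure_apply P (hMv j) j
  have hEn : ∀ δ : ℝ, 0 < δ → Tendsto (fun N => P N
      {z | δ < |empiricalEnergyField z (lamE θ 0) -
        ∫ x, lamE θ 0 x * totalEnergyDensity (ρ 0 x) (u 0 x) (θ 0 x)|}) atTop (𝓝 0) := by
    intro δ hδ
    refine (hLLN _ hcE δ hδ).2.2.congr fun N => ?_
    exact Clausius.localGibbsLaw_setOf_flow_zero a₀ u₀ θ₀ N (Φ N)
      (fun z => δ < |empiricalEnergyField z (lamE θ 0) -
        ∫ x, lamE θ 0 x * totalEnergyDensity (ρ 0 x) (u 0 x) (θ 0 x)|)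
  have hsum := EngineInitial.tendsto_measure_add P
    (EngineInitial.tendsto_measure_add P hD
      (EngineInitial.tendsto_measure_sum P Finset.univ fun j _ => hM j)) hEn
  -- convergence in probability of `X_N = Obs(0,·) − c` to `0`
  have hconv : ∀ δ : ℝ, 0 < δ → Tendsto (fun N => P N
      {w | δ < |(obs σ ρ θ u 0 w - ∫ x, Lcl σ ρ θ u 0 x (Ucl ρ θ u 0 x)) - 0|}) atTop (𝓝 0) := by
    intro δ hδ
    have h := hsum δ hδ
    simp_rw [sub_zero, EngineInitial.obs_eq_fields, hc_eq]
    exact h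
  -- uniform second moments
  obtain ⟨M₀, hM₀⟩ := stub_clausius_moment a₀ θ₀ u₀ ha hθ hu ha0 hθ0 σ hσ2
  obtain ⟨A0, -, hA0⟩ := exists_forall_abs_le_of_continuous hc0
  obtain ⟨AE, -, hAE⟩ := exists_forall_abs_le_of_continuous hcE
  obtain ⟨AM, -, hAM⟩ := exists_forall_abs_le_of_continuous hcM.norm
  have hAM' : ∀ x j, |lamM θ u 0 x j| ≤ AM := fun x j => by
    have h1 : |lamM θ u 0 x j| ≤ ‖lamM θ u 0 x‖ := by simpa using PiLp.norm_apply_le (lamM θ u 0 x) j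
    exact h1.trans (by simpa using hAM x)
  set c : ℝ := ∫ x, Lcl σ ρ θ u 0 x (Ucl ρ θ u 0 x) with hcdef
  set A : ℝ := A0 + 3 * AM / 2 + |c| with hAdef
  set B : ℝ := 3 * AM + AE with hBdef
  have hX2bd : ∀ (n : ℕ) (w : Config (n + 1) (Fin 3) T3),
      (obs σ ρ θ u 0 w - c) ^ 2 ≤ 2 * A ^ 2 + 2 * B ^ 2 * (empiricalEnergyField w fun _ => (1 : ℝ)) ^ 2 := by
    intro n w
    have h1 := EngineInitial.abs_obs_le hA0 hAM' hAE w
    have h2 : |obs σ ρ θ u 0 w - c| ≤ |obs σ ρ θ u 0 w| + |c| := abs_sub _ _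
    have h3 : |obs σ ρ θ u 0 w - c| ≤ A + B * empiricalEnergyField w fun _ => (1 : ℝ) := by
      rw [hAdef, hBdef]; linarith
    have h4 : |obs σ ρ θ u 0 w - c| ^ 2 ≤ (A + B * empiricalEnergyField w fun _ => (1 : ℝ)) ^ 2 :=
      pow_le_pow_left₀ (abs_nonneg _) h3 2
    rw [sq_abs] at h4
    nlinarith [sq_nonneg (A - B * empiricalEnergyField w fun _ => (1 : ℝ))]
  have hXm : ∀ N, Measurable fun w : Config (N + 1) (Fin 3) T3 => obs σ ρ θ u 0 w - c := fun N =>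
    (EngineInitial.measurable_obs hc0 hcM hcE N).sub measurable_const
  have hgi : ∀ N, Integrable
      (fun w => 2 * A ^ 2 + 2 * B ^ 2 * (empiricalEnergyField w fun _ => (1 : ℝ)) ^ 2) (P N) :=
    fun N => (integrable_const _).add ((hM₀ N (Φ N)).1.const_mul _)
  have hX2i : ∀ N, Integrable (fun w => (obs σ ρ θ u 0 w - c) ^ 2) (P N) := by
    intro N
    refine (hgi N).mono' ((hXm N).pow_const 2).aestronglyMeasurable (ae_of_all _ fun w => ?_)
    rw [Real.norm_eq_abs, abs_of_nonneg (sq_nonneg _)]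
    exact hX2bd N w
  have hX2 : ∀ N, ∫ w, (obs σ ρ θ u 0 w - c) ^ 2 ∂P N ≤ 2 * A ^ 2 + 2 * B ^ 2 * M₀ := by
    intro N
    obtain ⟨hI, hle⟩ := hM₀ N (Φ N)
    calc ∫ w, (obs σ ρ θ u 0 w - c) ^ 2 ∂P N
        ≤ ∫ w, (2 * A ^ 2 + 2 * B ^ 2 * (empiricalEnergyField w fun _ => (1 : ℝ)) ^ 2) ∂P N :=
          integral_mono (hX2i N) (hgi N) (hX2bd N)
      _ = 2 * A ^ 2 + 2 * B ^ 2 * ∫ w, (empiricalEnergyField w fun _ => (1 : ℝ)) ^ 2 ∂P N := by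
          rw [integral_add (integrable_const _) (hI.const_mul _), integral_const, smul_eq_mul,
            probReal_univ, one_mul, integral_const_mul]
      _ ≤ 2 * A ^ 2 + 2 * B ^ 2 * M₀ := by
          have := mul_le_mul_of_nonneg_left hle (by positivity : (0 : ℝ) ≤ 2 * B ^ 2)
          linarith
  -- means on the good event
  exact Clausius.tendsto_integral_indicator P hXm hX2i hX2 hconv hG hGc

end Barycentric

end Summit.AtomisticToContinuum.HydrodynamicLimit.Theorems.MacroClosureLine

end
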